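import Literature.Geometry.Kaehler.ComplexTorusLefschetzOneOneCycles
import Literature.Geometry.Kaehler.ComplexTorusAnalyticHypersurfaceSelfIntersection
import HarnessLib

/-!
# Effective divisor classes of a complex torus, and geometric Riemann–Roch for a hypersurface

Layer `Literature/Geometry/Kaehler`, namespace `Literature.Geometry.Kaehler.ComplexTorus`; lane
`lit-hodgefound` (Track 2 foundations library), skeleton seat `lit-hodgefound-skel-2` (generation 33),
plan row A2-115 — the successor of A2-113 (`ComplexTorusPoincareLelong`: `[Y]_e = c₁(𝒪_X(Y))`) and A2-114
(`ComplexTorusLefschetzOneOneCycles`: Lelong `c₁(L(H, χ)) = Σ_m [Y_m]_e` for every theta function).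

Sources followed. H. Lange, *Abelian Varieties over the Complex Numbers* (2023): §1.5.4 (a line bundle
`L` with `h⁰(L) > 0` is semi-positive, its divisor of a section effective), §2.1.1 p. 78 (divisors of
sections), §1.7.2 Thm. 1.7.3 (geometric Riemann–Roch `(L^g) = g! · d₁⋯d_g`), §1.5.3 Thm. 1.5.9 and
§2.1.3 p. 82 ("`h⁰(L) = χ(L) = d₁ · … · d_g`" for positive `L`), §2.1.3 Prop. 2.1.11 ((iv) `H⁰(L) ≠ 0`
and `(L^g) > 0` ⇒ (ii) `L` positive); C. Voisin, *Hodge Theory and Complex Algebraic Geometry I* (2002),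
§11.3.1 Thm. 11.33 (Lelong); W. Fulton, *Intersection Theory* (1998), §12.2 Example 12.2.1 (a).

## Contents (theorems only; no definition, no named fact, net debt `0`)

* §1 `mul_mem_thetaFunctions_add_mul'` (products of theta functions of types `(H, χ)`, `(H', χ')`),
  **`exists_thetaFunction_sum_analyticCycleClass_eq`**: for every finite family of analytic hypersurfaces
  `Y₁, …, Y_k` of `X` there are `(H, χ)` and a theta function `ϑ ≢ 0` of type `(H, χ)` with
  `{ϑ = 0} = ⋃ᵢ π⁻¹Yᵢ` and `Σᵢ [Yᵢ]_e = ofRealForm (-Im H)` (the product of the minimal theta functions of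
  A2-113) — with A2-114 §4 the EFFECTIVE classes `{Σᵢ [Yᵢ]_e}` are exactly the classes
  `{ofRealForm (-E) : (E, χ) with h⁰(L(E, χ)) > 0}` (`sum_analyticCycleClass_iff_exists_thetaFunction`).
* §2 **`eq_of_analyticCycleClass_eq_ofRealForm_neg`** (the form `E` with `[D]_e = ofRealForm (-E)` is unique,
  hence IS `Im H(𝒪_X(D))`), **`torusIntegral_wedgePow_analyticCycleClass_eq_factorial_mul_h0`** — geometric
  Riemann–Roch for an analytic hypersurface `D` with `(D^g) ≠ 0`: `𝒪_X(D) ≅ L(H, χ)` is POSITIVE and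
  `(D^g) = ∫_X [D]^{∧g} = g! · h⁰(L(H, χ))`, and `torusIntegral_wedgePow_analyticCycleClass_eq_factorial_mul_finrank`
  (`= g! · dim {theta functions of the type of the minimal theta function ϑ_D}`).

## References

* [Lange2023AbelianVarietiesComplex] H. Lange, *Abelian Varieties over the Complex Numbers* (2023),
  §1.5.3 Thm. 1.5.9, §1.5.4, §1.7.2 Thm. 1.7.3, §2.1.1 (p. 78), §2.1.3 Prop. 2.1.11 (p. 82).
* [VoisinHodgeI2002] C. Voisin, *Hodge Theory and Complex Algebraic Geometry I* (2002), §11.3.1 Thm. 11.33.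
* [Fulton1998] W. Fulton, *Intersection Theory* (1998), §12.2 Example 12.2.1 (a).
-/

noncomputable section

open scoped Manifold Topology ComplexOrder
open Set Filter Function Module TopologicalSpace Complex MeasureTheory

namespace Literature.Geometry.Kaehler

namespace ComplexTorus

universe u

/-! ### §1 Products of theta functions and the effective classes -/

section Effective

variable {ι : Type*} [Fintype ι] [DecidableEq ι] {E : Type u} [NormedAddCommGroup E]
  [InnerProductSpace ℂ E] [FiniteDimensional ℂ E] [MeasurableSpace E] [BorelSpace E]
  (Φ : (ι → ℝ) ≃L[ℝ] E) {n d : ℕ} (e : Fin n ≃ ι) (h : 2 * d + 2 = n)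

omit [Fintype ι] [DecidableEq ι] [FiniteDimensional ℂ E] [MeasurableSpace E] [BorelSpace E] in
/-- **Products of theta functions**: `ϑ ∈ H⁰(L(H, χ))`, `ϑ' ∈ H⁰(L(H', χ'))` ⇒ `ϑϑ' ∈ H⁰(L(H + H', χχ'))`
(`a_{(H,χ)} a_{(H',χ')} = a_{(H+H',χχ')}`). [cite: Lange2023AbelianVarietiesComplex, §1.3.1 Lemma 1.3.1 (ii)] -/
theorem mul_mem_thetaFunctions_add_mul' {η η' : E [⋀^Fin 2]→L[ℝ] ℝ} {χ χ' : (ι → ℤ) → ℂ} {θ θ' : E → ℂ}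
    (hθ : θ ∈ thetaFunctions Φ (canonicalFactor Φ η χ))
    (hθ' : θ' ∈ thetaFunctions Φ (canonicalFactor Φ η' χ')) :
    (fun v => θ v * θ' v) ∈ thetaFunctions Φ (canonicalFactor Φ (η + η') (χ * χ')) := by
  obtain ⟨hθd, hθe⟩ := mem_thetaFunctions_iff.1 hθ
  obtain ⟨hθ'd, hθ'e⟩ := mem_thetaFunctions_iff.1 hθ'
  rw [canonicalFactor_add_mul]
  refine mem_thetaFunctions_iff.2 ⟨hθd.mul hθ'd, fun m v => ?_⟩
  simp only [Pi.mul_apply, hθe m v, hθ'e m v]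
  ring

include h in
/-- **Every finite sum of hypersurface classes is the class of a line bundle with a section**: for closed
analytic hypersurfaces `Y₁, …, Y_k` of `X = E/Λ` (pure dimension `d`, `rk Λ = 2d + 2`, `e` positively
oriented) there are `H ∈ NS(X)`, a semicharacter `χ` and a theta function `ϑ ≢ 0` of type `(H, χ)` — the
product of the minimal theta functions `ϑ_{Yᵢ}` of A2-113 — with `{ϑ = 0} = ⋃ᵢ π⁻¹Yᵢ` and
`Σᵢ [Yᵢ]_e = ofRealForm (-Im H) = c₁(L(H, χ))` ("the divisor `D = Σ Yᵢ` is the divisor of the section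
`Π σᵢ` of `⊗ 𝒪(Yᵢ)`"). [cite: VoisinHodgeI2002, §11.3.1 Thm. 11.33 (proof)] [cite: Lange2023AbelianVarietiesComplex, §2.1.1 (p. 78)] -/
theorem exists_thetaFunction_sum_analyticCycleClass_eq (he : orientationSign Φ e = 1) {k : ℕ}
    (Y : Fin k → {Z : Set (ComplexTorus Φ) // HasPureDim 𝓘(ℂ, E) Z d}) :
    ∃ (η : E [⋀^Fin 2]→L[ℝ] ℝ) (χ : (ι → ℤ) → ℂ) (ϑ : E → ℂ), IsNSForm Φ η ∧ IsSemicharacter Φ η χ ∧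
      ϑ ∈ thetaFunctions Φ (canonicalFactor Φ η χ) ∧ ϑ ≠ 0 ∧
      {v | ϑ v = 0} = ⋃ i, cover Φ ⁻¹' (Y i).1 ∧
      ∑ i, analyticCycleClass Φ e h (Y i).2 = ofRealForm (-η) := by
  induction k with
  | zero =>
    refine ⟨0, 1, fun _ => 1, ⟨fun u v => by simp, fun m m' => ⟨0, by simp⟩⟩, ?_, ?_, ?_, ?_, ?_⟩
    · exact ⟨fun m => by simp, fun m m' => by simp⟩
    · refine mem_thetaFunctions_iff.2 ⟨differentiable_const _, fun m v => ?_⟩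
      rw [canonicalFactor_zero_one, Pi.one_apply, Pi.one_apply, one_mul]
    · exact fun h0 => one_ne_zero (congr_fun h0 0)
    · ext v; simp
    · rw [Finset.univ_eq_empty, Finset.sum_empty, neg_zero, ofRealForm_zero]
  | succ k ih =>
    obtain ⟨η', χ', ϑ', hη', hχ', hϑ', hϑ'0, hzero', hsum'⟩ := ih (Fin.tail Y)
    obtain ⟨-, η₀, χ₀, hη₀, hχ₀, ϑ₀, -, -, hϑ₀, hϑ₀0, hzero₀, -, hcl₀⟩ :=
      analyticCycleClass_eq_chernClass_of_hasPureDim Φ e h (Y 0).2 he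
    refine ⟨η₀ + η', χ₀ * χ', fun v => ϑ₀ v * ϑ' v, hη₀.add hη', hχ₀.mul hχ',
      mul_mem_thetaFunctions_add_mul' Φ hϑ₀ hϑ', ?_, ?_, ?_⟩
    · -- the product of two non-zero entire functions is non-zero: `{ϑ₀ ≠ 0}` is dense and open ∩
      intro h0
      have hd₀ : Dense {v | ϑ₀ v ≠ 0} := by
        have hdim : finrank ℂ E = d + 1 := finrank_eq_succ_of_rank Φ e h
        have hYc : HasPureCodim 𝓘(ℂ, E) (Y 0).1 1 := by
          have := (Y 0).2.hasPureCodim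
          rwa [hdim, show d + 1 - d = 1 by omega] at this
        have hint : interior {v | ϑ₀ v = 0} = ∅ := by
          rw [hzero₀]
          exact SCV.interior_eq_empty_of_hasPureCodim (hasPureCodim_cover_preimage (Φ := Φ) hYc)
        have := interior_eq_empty_iff_dense_compl.1 hint
        convert this using 1
        ext v
        simp
      -- `ϑ'` vanishes on the dense open set `{ϑ₀ ≠ 0}`, hence everywhere
      have hϑ'd : Continuous ϑ' := (mem_thetaFunctions_iff.1 hϑ').1.continuous
      have hopen : IsOpen {v | ϑ₀ v ≠ 0} :=
        isOpen_ne_fun (mem_thetaFunctions_iff.1 hϑ₀).1.continuous continuous_const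
      have hsub : {v | ϑ₀ v ≠ 0} ⊆ {v | ϑ' v = 0} := fun v hv => by
        have := congr_fun h0 v
        simp only [Pi.zero_apply, mul_eq_zero] at this
        exact this.resolve_left hv
      have hcl : IsClosed {v | ϑ' v = 0} := isClosed_eq hϑ'd continuous_const
      have hall : {v | ϑ' v = 0} = univ := by
        have := hcl.closure_subset_iff.2 hsub
        rw [hd₀.closure_eq] at this
        exact eq_univ_of_univ_subset this
      exact hϑ'0 (funext fun v => by
        have hv : v ∈ {v | ϑ' v = 0} := hall ▸ mem_univ v
        exact hv)
    · ext v
      simp only [mem_setOf_eq, mul_eq_zero, mem_iUnion]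
      constructor
      · rintro (h0 | h0)
        · exact ⟨0, by
            have : v ∈ {w | ϑ₀ w = 0} := h0
            rw [hzero₀] at this
            exact this⟩
        · have : v ∈ {w | ϑ' w = 0} := h0
          rw [hzero'] at this
          obtain ⟨j, hj⟩ := mem_iUnion.1 this
          exact ⟨j.succ, hj⟩
      · rintro ⟨i, hi⟩
        refine Fin.cases (fun hi => ?_) (fun j hj => ?_) i hi
        · left
          have : v ∈ cover Φ ⁻¹' (Y 0).1 := hi
          rw [← hzero₀] at this
          exact this
        · right
          have : v ∈ ⋃ j, cover Φ ⁻¹' (Fin.tail Y j).1 := mem_iUnion.2 ⟨j, hj⟩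
          rw [← hzero'] at this
          exact this
    · rw [Fin.sum_univ_succ, hcl₀, show (fun i : Fin k => analyticCycleClass Φ e h (Y i.succ).2) =
        fun i => analyticCycleClass Φ e h (Fin.tail Y i).2 from rfl, hsum', ← ofRealForm_add, neg_add]

include h in
/-- **The effective classes.** A class in `H²(X, ℂ)` is a finite sum of fundamental classes of analytic
hypersurfaces of `X` if and only if it is `ofRealForm (-Im H) = c₁(L(H, χ))` for some `H ∈ NS(X)` and
semicharacter `χ` with `h⁰(L(H, χ)) ≠ 0` (a non-zero theta function of type `(H, χ)`): `⇒` by the product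
of minimal theta functions, `⇐` by Lelong's theorem in layer-cake form (A2-114). (Lange §1.5.4: the line
bundles with `h⁰ > 0`; their `H` is positive semi-definite.) [cite: Lange2023AbelianVarietiesComplex, §1.5.4 and §2.1.1 (p. 78)]
[cite: VoisinHodgeI2002, §11.3.1 Thm. 11.33] -/
theorem sum_analyticCycleClass_iff_exists_thetaFunction (he : orientationSign Φ e = 1)
    (γ : E [⋀^Fin 2]→L[ℝ] ℂ) :
    (∃ (k : ℕ) (Y : Fin k → {Z : Set (ComplexTorus Φ) // HasPureDim 𝓘(ℂ, E) Z d}),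
        γ = ∑ i, analyticCycleClass Φ e h (Y i).2) ↔
      ∃ (η : E [⋀^Fin 2]→L[ℝ] ℝ) (χ : (ι → ℤ) → ℂ) (ϑ : E → ℂ), IsNSForm Φ η ∧ IsSemicharacter Φ η χ ∧
        ϑ ∈ thetaFunctions Φ (canonicalFactor Φ η χ) ∧ ϑ ≠ 0 ∧ γ = ofRealForm (-η) := by
  constructor
  · rintro ⟨k, Y, rfl⟩
    obtain ⟨η, χ, ϑ, hη, hχ, hϑ, hϑ0, -, hsum⟩ := exists_thetaFunction_sum_analyticCycleClass_eq Φ e h he Y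
    exact ⟨η, χ, ϑ, hη, hχ, hϑ, hϑ0, hsum⟩
  · rintro ⟨η, χ, ϑ, hη, hχ, hϑ, hϑ0, rfl⟩
    obtain ⟨k, Y, -, hsum⟩ := exists_sum_analyticCycleClass_eq_of_thetaFunction Φ e h he hη hχ hϑ hϑ0
    exact ⟨k, Y, hsum⟩

end Effective

/-! ### §2 Geometric Riemann–Roch for a hypersurface: `(D^g) = g! · h⁰(𝒪_X(D))` -/

section RiemannRoch

variable {ι : Type*} [Fintype ι] [DecidableEq ι] {E : Type u} [NormedAddCommGroup E]
  [InnerProductSpace ℂ E] [FiniteDimensional ℂ E] [MeasurableSpace E] [BorelSpace E]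
  (Φ : (ι → ℝ) ≃L[ℝ] E) {g q : ℕ} (e : Fin (2 * g) ≃ ι)

/-- **The Néron–Severi form of a hypersurface is unique**: if `[D]_e = ofRealForm (-E)` and
`[D]_e = ofRealForm (-E')` then `E = E'` (`ofRealForm` is injective) — so the semi-positive form of leaf
(lix), the Riemann form of `exists_isRiemannForm_analyticCycleClass_eq_of_torusIntegral_wedgePow_ne_zero`
and the Appell–Humbert form `Im H(𝒪_X(D))` of A2-113 all coincide.
[cite: Lange2023AbelianVarietiesComplex, §1.1.3 Cor. 1.1.19 and §2.1.1] -/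
theorem eq_of_analyticCycleClass_eq_ofRealForm_neg (hq : 2 * q + 2 * 1 = 2 * g) {D : Set (ComplexTorus Φ)}
    (hD : HasPureDim 𝓘(ℂ, E) D q) {η η' : E [⋀^Fin 2]→L[ℝ] ℝ}
    (hη : analyticCycleClass Φ e hq hD = ofRealForm (-η))
    (hη' : analyticCycleClass Φ e hq hD = ofRealForm (-η')) : η = η' := by
  have h1 : ofRealForm (-η) = ofRealForm (-η') := hη ▸ hη'
  exact neg_injective (ofRealForm_injective h1)

/-- **Geometric Riemann–Roch for an analytic hypersurface of a complex torus.** Let `D ⊂ X = E/Λ`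
(`dim X = g`, `e` positively oriented) be a closed analytic hypersurface with `(D^g) = ∫_X [D]^{∧g} ≠ 0`.
Then the line bundle `𝒪_X(D) ≅ L(H, χ)` of `D` (A2-113: `(H, χ)` its Appell–Humbert datum, `ϑ` the
minimal theta function of `π⁻¹D`, `[D]_e = ofRealForm (-Im H)`) is POSITIVE (`Im H` a Riemann form —
Prop. 2.1.11 (iv) ⇒ (ii)) and

  `(D^g) = g! · h⁰(L(H, χ))`

(Thm. 1.7.3 `(L^g) = g! · d₁⋯d_g` with Thm. 1.5.9 / p. 82 "`h⁰(L) = χ(L) = d₁ · … · d_g`").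
[cite: Lange2023AbelianVarietiesComplex, §1.7.2 Thm. 1.7.3, §1.5.3 Thm. 1.5.9 and §2.1.3 Prop. 2.1.11]
[cite: Fulton1998, §12.2 Example 12.2.1 (a)] -/
theorem torusIntegral_wedgePow_analyticCycleClass_eq_factorial_mul_h0 (hq : 2 * q + 2 * 1 = 2 * g)
    {D : Set (ComplexTorus Φ)} (hD : HasPureDim 𝓘(ℂ, E) D q) (he : orientationSign Φ e = 1)
    (hDg : torusIntegral Φ e (wedgePow (analyticCycleClass Φ e hq hD) g) ≠ 0) :
    ∃ (D' : EffectiveCartierDivisor (Option ↥D) E (ComplexTorus Φ)) (η : E [⋀^Fin 2]→L[ℝ] ℝ)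
      (χ : (ι → ℤ) → ℂ) (hη : IsRiemannForm Φ η) (hχ : IsSemicharacter Φ η χ) (ϑ : E → ℂ),
      D'.support = D ∧
      (D'.lineBundle.tensor (factorLineBundle (isFactor_canonicalFactor Φ (hη.isNSForm Φ) hχ).inv)).IsTrivialOn
        univ ∧
      ϑ ∈ thetaFunctions Φ (canonicalFactor Φ η χ) ∧ ϑ ≠ 0 ∧ {w | ϑ w = 0} = cover Φ ⁻¹' D ∧
      analyticCycleClass Φ e hq hD = ofRealForm (-η) ∧
      torusIntegral Φ e (wedgePow (analyticCycleClass Φ e hq hD) g) =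
        (g.factorial : ℂ) * ((lineBundleAH (hη.isNSForm Φ) hχ).h0 : ℂ) := by
  have h' : 2 * q + 2 = 2 * g := by omega
  obtain ⟨D', η, χ, hη, hχ, ϑ, hsupp, htriv, hϑ, hϑ0, hzero, -, hcl⟩ :=
    analyticCycleClass_eq_chernClass_of_hasPureDim Φ e h' hD he
  have hcast : analyticCycleClass Φ e hq hD = analyticCycleClass Φ e h' hD := rfl
  have hpos : ∀ v : E, 0 ≤ η ![I • v, v] := twoForm_I_smul_self_nonneg_of_thetaFunction Φ hη hχ hϑ hϑ0
  have hR : IsRiemannForm Φ η :=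
    hη.isRiemannForm_of_semipos_of_torusIntegral_wedgePow_ne_zero hpos e (by rwa [hcast, hcl] at hDg)
  refine ⟨D', η, χ, hR, hχ, ϑ, hsupp, htriv, hϑ, hϑ0, hzero, hcast.trans hcl, ?_⟩
  rw [hcast, hcl]
  obtain ⟨g', dd, hd, -⟩ := hR.exists_isPolarizationType
  have hg : g' = g := by
    have h1 := hd.card_eq
    have h2 : Fintype.card (Fin (2 * g)) = Fintype.card ι := Fintype.card_congr e
    rw [Fintype.card_fin] at h2
    omega
  subst hg
  exact hR.torusIntegral_wedgePow_neg_eq_factorial_mul_h0 hd hχ e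

/-- **`(D^g) = g! · dim H⁰(L(H, χ))` in terms of theta functions**: with `(H, χ)` and the minimal theta
function `ϑ_D ∈ H⁰(L(H, χ))` of A2-113, `(D^g) = g! · dim_ℂ {theta functions of type (H, χ)}` when
`(D^g) ≠ 0`. [cite: Lange2023AbelianVarietiesComplex, §1.7.2 Thm. 1.7.3 and §1.2.1 Prop. 1.2.3] -/
theorem torusIntegral_wedgePow_analyticCycleClass_eq_factorial_mul_finrank (hq : 2 * q + 2 * 1 = 2 * g)
    {D : Set (ComplexTorus Φ)} (hD : HasPureDim 𝓘(ℂ, E) D q) (he : orientationSign Φ e = 1)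
    (hDg : torusIntegral Φ e (wedgePow (analyticCycleClass Φ e hq hD) g) ≠ 0) :
    ∃ (η : E [⋀^Fin 2]→L[ℝ] ℝ) (χ : (ι → ℤ) → ℂ) (ϑ : E → ℂ), IsRiemannForm Φ η ∧ IsSemicharacter Φ η χ ∧
      ϑ ∈ thetaFunctions Φ (canonicalFactor Φ η χ) ∧ ϑ ≠ 0 ∧ {w | ϑ w = 0} = cover Φ ⁻¹' D ∧
      analyticCycleClass Φ e hq hD = ofRealForm (-η) ∧
      torusIntegral Φ e (wedgePow (analyticCycleClass Φ e hq hD) g) =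
        (g.factorial : ℂ) * (finrank ℂ (thetaFunctions Φ (canonicalFactor Φ η χ)) : ℂ) := by
  obtain ⟨-, η, χ, hR, hχ, ϑ, -, -, hϑ, hϑ0, hzero, hcl, hint⟩ :=
    torusIntegral_wedgePow_analyticCycleClass_eq_factorial_mul_h0 Φ e hq hD he hDg
  refine ⟨η, χ, ϑ, hR, hχ, hϑ, hϑ0, hzero, hcl, ?_⟩
  rw [hint, finrank_thetaFunctions_eq_h0 (isFactor_canonicalFactor Φ (hR.isNSForm Φ) hχ)]

end RiemannRoch

end ComplexTorus

end Literature.Geometry.Kaehler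

end
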